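import Summits.QuantumFields.BalabanUV.Beta.GAN24.FaceWordEEValueZero

/-!
# `BalabanUV.Beta.GAN24.FaceWordEEDiagZero` — binder row G-an2-4 ∕ (CONV-C), W-slot (α-0), typer's PART VI row **T6-VAL**, the (γ) hand's letter **K7-0** (E⊗E sector at LEVEL `0`):
# **THE LEVEL-`0` E⊗E FACE WORD AT THE DEEP PERIOD VANISHES ON THE DIAGONAL PATTERNS** (`β = ν` on the right bond∕leg, `α = μ` on the left) — the two-face current of the Wilson
# cubic table with slot direction equal to the weighted leg's coordinate is zero (leaf-04's `RespGaugeStencil.hasSum_pair_faceface_wilsonA_diag`), exactly as the diagonal staircase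
# currents vanish at levels `≥ 1` (g56's `FaceWordEEDiagDeep`) (G-an2-4 CRUX TEAM (2), seat `b2b-balaban-gan24-formalise-leaf-06` = the (γ) hand, gen 57; journal [GAN24LEAF06-G57-INTENT-1])

NOT IN PRINT; OUR BOOKKEEPING ([folklore] BY NAME over leaf-04's `RespGaugeStencil.tsum_ite_ite_wilsonA_eq_pair ∕ hasSum_pair_faceface_wilsonA_diag` and `WilsonCurrentSym.tsum_tsum_wilsonA_eq_neg_pair`,
this seat's `FaceWordEEValueZero.faceface_unitS_smul_wilsonA`; the TEXT of g56's `FaceWordEEDiagDeep` §2 with `e3OfK …(SrecAt … j) ↦ wilsonA d`, `j+1 ↦ 0`; 0 `def`, 0 cited fact,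
0 `def … : Prop`, 0 sorry).  HONEST FRAMING (cell contract, verbatim): «discharging `BetaPertH` makes Bałaban's UV stability UNCONDITIONAL — a real constructive-QFT result; it is NOT
the continuum limit and NOT the Clay problem.»  HONEST DEPENDENCY (verbatim): «continuum YM on T⁴ ⇐ BetaPertH ∧ nine spine estimates (0/9 proved); BetaPertH ⇐ (D1) ∧ (D4) ∧ CAP+tail;
G-an2-4 gates asym, D1 and NE2/3/4.»

WHAT ([folklore]; generic `d`, in-block root, `Lc, N ≥ 1`, units `sf sm`, amplitude `cE`): §1 `faceface_wilsonA_diag_eq_zero` (second-leg form, slot = weighted leg coordinate),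
`faceface_wilsonA_diag_eq_zero_fst` (first-leg form); §2 **`cellPairing_zero_eq_zero_of_right_diag ∕ _of_left_diag`** (raw table) and **`…_units`** (table `unitS sf sm (cE • wilsonA d)`):
the cell pairing of `FaceWordEEValueZero.cellPairing_zero_value` with `β = ν` resp. `α = μ` is `0`.  Asserts NO value of Bałaban's tables beyond these identities; discharges NOTHING of
`hX` ∕ `hXu` ∕ (C)_{≥1} ∕ `hB0` ∕ `hBF` ∕ (Q-L); NEVER «G-an2-4 closed» as (CONV-C); NOT D1, NOT `BetaPertH`, NOT continuum, NOT Clay.  2026-08-24; no existing file touched.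
-/

noncomputable section

open Finset
open scoped BigOperators
open Literature.MathematicalPhysics.QuantumFieldTheory
open Literature.MathematicalPhysics.QuantumFieldTheory.Balaban1983to89
open Literature.MathematicalPhysics.QuantumFieldTheory.Balaban1983to89.Beta
open ExpKernelCalculus (Site MKer)
open AffineAveraging (box toSite)
open OneStepResolventKernel (Fib)
open OneStepKernelFamily (KInvStep)
open StepJetData (wilsonA)
open Summit.QuantumFields.BalabanUV.Beta.AxialDressingRooted (coDressKBmAt one_le_of_neZero)
open Summit.QuantumFields.BalabanUV.Beta.HessKerDressedUnits (unitK unitS)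
open Summit.QuantumFields.BalabanUV.Beta.GAN24.RespGaugeStencil (tsum_ite_ite_wilsonA_eq_pair hasSum_pair_faceface_wilsonA_diag)
open Summit.QuantumFields.BalabanUV.Beta.GAN24.WilsonCurrentSym (tsum_tsum_wilsonA_eq_neg_pair)
open Summit.QuantumFields.BalabanUV.Beta.GAN24.FaceWordEEValueZero (faceface_unitS_smul_wilsonA)

namespace Summit.QuantumFields.BalabanUV.Beta.GAN24.FaceWordEEDiagZero

variable {d : ℕ} {Lc : ℕ} [NeZero Lc] {r : Fin (d + 1) → ℕ}

/-! ## §1 The diagonal two-face currents of the Wilson cubic table vanish -/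

omit [NeZero Lc] in
/-- [folklore] **SECOND-LEG FORM, SLOT DIRECTION = WEIGHTED COORDINATE**: `Σ'_w χ_M(w_ν)·Σ'_t [t_ν face]·wilsonA d ν t z w (inl b)(inl ν) = 0` (every period `M`, every free leg). -/
theorem faceface_wilsonA_diag_eq_zero (M : ℕ) (ν : Fin (d + 1)) (z : Site (d + 1)) (b : Fin (d + 1)) :
    (∑' w : Site (d + 1), (if w ν % (M : ℤ) = (M : ℤ) - 1 then (1 : ℝ) else 0) *
        ∑' t : Site (d + 1), (if t ν % (M : ℤ) = (M : ℤ) - 1 then wilsonA d ν t z w (Sum.inl b) (Sum.inl ν) else 0)) = 0 := by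
  have h1 : (∑' w : Site (d + 1), (if w ν % (M : ℤ) = (M : ℤ) - 1 then (1 : ℝ) else 0) *
        ∑' t : Site (d + 1), (if t ν % (M : ℤ) = (M : ℤ) - 1 then wilsonA d ν t z w (Sum.inl b) (Sum.inl ν) else 0)) =
      ∑' w : Site (d + 1), (if w ν % (M : ℤ) = (M : ℤ) - 1 then
        ∑' t : Site (d + 1), (if t ν % (M : ℤ) = (M : ℤ) - 1 then wilsonA d ν t z w (Sum.inl b) (Sum.inl ν) else 0) else 0) := by
    refine tsum_congr fun w => ?_
    split_ifs <;> simp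
  rw [h1, tsum_ite_ite_wilsonA_eq_pair M ν ν b z]
  exact (hasSum_pair_faceface_wilsonA_diag (d := d) ν (fun n : ℤ => if n % (M : ℤ) = (M : ℤ) - 1 then (1 : ℝ) else 0)
    (fun n : ℤ => if n % (M : ℤ) = (M : ℤ) - 1 then (1 : ℝ) else 0) b z).tsum_eq

omit [NeZero Lc] in
/-- [folklore] **FIRST-LEG FORM, SLOT DIRECTION = WEIGHTED COORDINATE**: `Σ'_y χ_M(y_μ)·Σ'_t [t_μ face]·wilsonA d μ t y x (inl μ)(inl a) = 0`. -/
theorem faceface_wilsonA_diag_eq_zero_fst (M : ℕ) (μ : Fin (d + 1)) (x : Site (d + 1)) (a : Fin (d + 1)) :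
    (∑' y : Site (d + 1), (if y μ % (M : ℤ) = (M : ℤ) - 1 then (1 : ℝ) else 0) *
        ∑' t : Site (d + 1), (if t μ % (M : ℤ) = (M : ℤ) - 1 then wilsonA d μ t y x (Sum.inl μ) (Sum.inl a) else 0)) = 0 := by
  have h1 : (∑' y : Site (d + 1), (if y μ % (M : ℤ) = (M : ℤ) - 1 then (1 : ℝ) else 0) *
        ∑' t : Site (d + 1), (if t μ % (M : ℤ) = (M : ℤ) - 1 then wilsonA d μ t y x (Sum.inl μ) (Sum.inl a) else 0)) =
      ∑' y : Site (d + 1), (if y μ % (M : ℤ) = (M : ℤ) - 1 then (1 : ℝ) else 0) *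
        ∑' t : Site (d + 1), (if t μ % (M : ℤ) = (M : ℤ) - 1 then (1 : ℝ) else 0) * wilsonA d μ t y x (Sum.inl μ) (Sum.inl a) := by
    refine tsum_congr fun y => ?_
    congr 1
    refine tsum_congr fun t => ?_
    split_ifs <;> simp
  rw [h1, tsum_tsum_wilsonA_eq_neg_pair μ μ a (fun n : ℤ => if n % (M : ℤ) = (M : ℤ) - 1 then (1 : ℝ) else 0)
      (fun n : ℤ => if n % (M : ℤ) = (M : ℤ) - 1 then (1 : ℝ) else 0) x,
    (hasSum_pair_faceface_wilsonA_diag (d := d) μ (fun n : ℤ => if n % (M : ℤ) = (M : ℤ) - 1 then (1 : ℝ) else 0)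
      (fun n : ℤ => if n % (M : ℤ) = (M : ℤ) - 1 then (1 : ℝ) else 0) a x).tsum_eq, neg_zero]

/-! ## §2 Hence the level-`0` cell pairing vanishes on the diagonal patterns -/

/-- NOT IN PRINT; OUR BOOKKEEPING.  **RIGHT DIAGONAL (`β = ν`): the cell pairing of `FaceWordEEValueZero.cellPairing_zero_value` is `0`.** -/
theorem cellPairing_zero_eq_zero_of_right_diag (sf sm : ℝ) (N : ℕ) [NeZero N] (μ α ν : Fin (d + 1)) :
    ∑ x ∈ box (d + 1) (Lc * N), ∑ a : Fin (d + 1),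
        (∑' y : Site (d + 1), (if y α % ((Lc * N : ℕ) : ℤ) = ((Lc * N : ℕ) : ℤ) - 1 then (1 : ℝ) else 0) *
          ∑' t : Site (d + 1), (if t μ % ((Lc * N : ℕ) : ℤ) = ((Lc * N : ℕ) : ℤ) - 1 then
            wilsonA d μ t y (toSite x) (Sum.inl α) (Sum.inl a)
            else 0)) *
        (∑' z : Site (d + 1), ∑ b : Fin (d + 1), unitK sf sm (coDressKBmAt (toSite r) Lc (KInvStep (d := d) Lc 0)) (toSite x) z (Sum.inl a) (Sum.inl b) *
          (∑' w : Site (d + 1), (if w ν % ((Lc * N : ℕ) : ℤ) = ((Lc * N : ℕ) : ℤ) - 1 then (1 : ℝ) else 0) *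
            ∑' t : Site (d + 1), (if t ν % ((Lc * N : ℕ) : ℤ) = ((Lc * N : ℕ) : ℤ) - 1 then
              wilsonA d ν t z w (Sum.inl b) (Sum.inl ν)
              else 0))) = 0 := by
  refine Finset.sum_eq_zero fun x _ => Finset.sum_eq_zero fun a _ => ?_
  have hR : ∀ (z : Site (d + 1)) (b : Fin (d + 1)),
      (∑' w : Site (d + 1), (if w ν % ((Lc * N : ℕ) : ℤ) = ((Lc * N : ℕ) : ℤ) - 1 then (1 : ℝ) else 0) *
        ∑' t : Site (d + 1), (if t ν % ((Lc * N : ℕ) : ℤ) = ((Lc * N : ℕ) : ℤ) - 1 then wilsonA d ν t z w (Sum.inl b) (Sum.inl ν) else 0)) = 0 :=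
    fun z b => faceface_wilsonA_diag_eq_zero (Lc * N) ν z b
  simp_rw [hR, mul_zero, Finset.sum_const_zero, tsum_zero, mul_zero]

/-- NOT IN PRINT; OUR BOOKKEEPING.  **LEFT DIAGONAL (`α = μ`): the cell pairing is `0`.** -/
theorem cellPairing_zero_eq_zero_of_left_diag (sf sm : ℝ) (N : ℕ) [NeZero N] (μ ν β : Fin (d + 1)) :
    ∑ x ∈ box (d + 1) (Lc * N), ∑ a : Fin (d + 1),
        (∑' y : Site (d + 1), (if y μ % ((Lc * N : ℕ) : ℤ) = ((Lc * N : ℕ) : ℤ) - 1 then (1 : ℝ) else 0) *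
          ∑' t : Site (d + 1), (if t μ % ((Lc * N : ℕ) : ℤ) = ((Lc * N : ℕ) : ℤ) - 1 then
            wilsonA d μ t y (toSite x) (Sum.inl μ) (Sum.inl a)
            else 0)) *
        (∑' z : Site (d + 1), ∑ b : Fin (d + 1), unitK sf sm (coDressKBmAt (toSite r) Lc (KInvStep (d := d) Lc 0)) (toSite x) z (Sum.inl a) (Sum.inl b) *
          (∑' w : Site (d + 1), (if w β % ((Lc * N : ℕ) : ℤ) = ((Lc * N : ℕ) : ℤ) - 1 then (1 : ℝ) else 0) *
            ∑' t : Site (d + 1), (if t ν % ((Lc * N : ℕ) : ℤ) = ((Lc * N : ℕ) : ℤ) - 1 then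
              wilsonA d ν t z w (Sum.inl b) (Sum.inl β)
              else 0))) = 0 := by
  refine Finset.sum_eq_zero fun x _ => Finset.sum_eq_zero fun a _ => ?_
  rw [faceface_wilsonA_diag_eq_zero_fst (Lc * N) μ (toSite x) a, zero_mul]

/-- NOT IN PRINT; OUR BOOKKEEPING.  **RIGHT DIAGONAL, UNIT-SCALED TABLE** `unitS sf sm (cE • wilsonA d)`: the cell pairing is `0`. -/
theorem cellPairing_zero_eq_zero_of_right_diag_units (sf sm cE : ℝ) (N : ℕ) [NeZero N] (μ α ν : Fin (d + 1)) :
    ∑ x ∈ box (d + 1) (Lc * N), ∑ a : Fin (d + 1),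
        (∑' y : Site (d + 1), (if y α % ((Lc * N : ℕ) : ℤ) = ((Lc * N : ℕ) : ℤ) - 1 then (1 : ℝ) else 0) *
          ∑' t : Site (d + 1), (if t μ % ((Lc * N : ℕ) : ℤ) = ((Lc * N : ℕ) : ℤ) - 1 then
            unitS sf sm (fun κ u => cE • wilsonA d κ u) μ t y (toSite x) (Sum.inl α) (Sum.inl a)
            else 0)) *
        (∑' z : Site (d + 1), ∑ b : Fin (d + 1), unitK sf sm (coDressKBmAt (toSite r) Lc (KInvStep (d := d) Lc 0)) (toSite x) z (Sum.inl a) (Sum.inl b) *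
          (∑' w : Site (d + 1), (if w ν % ((Lc * N : ℕ) : ℤ) = ((Lc * N : ℕ) : ℤ) - 1 then (1 : ℝ) else 0) *
            ∑' t : Site (d + 1), (if t ν % ((Lc * N : ℕ) : ℤ) = ((Lc * N : ℕ) : ℤ) - 1 then
              unitS sf sm (fun κ u => cE • wilsonA d κ u) ν t z w (Sum.inl b) (Sum.inl ν)
              else 0))) = 0 := by
  refine Finset.sum_eq_zero fun x _ => Finset.sum_eq_zero fun a _ => ?_
  have hR : ∀ (z : Site (d + 1)) (b : Fin (d + 1)),
      (∑' w : Site (d + 1), (if w ν % ((Lc * N : ℕ) : ℤ) = ((Lc * N : ℕ) : ℤ) - 1 then (1 : ℝ) else 0) *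
        ∑' t : Site (d + 1), (if t ν % ((Lc * N : ℕ) : ℤ) = ((Lc * N : ℕ) : ℤ) - 1 then
          unitS sf sm (fun κ u => cE • wilsonA d κ u) ν t z w (Sum.inl b) (Sum.inl ν) else 0)) = 0 := by
    intro z b
    rw [faceface_unitS_smul_wilsonA sf sm cE ν (fun t : Site (d + 1) => t ν % ((Lc * N : ℕ) : ℤ) = ((Lc * N : ℕ) : ℤ) - 1)
      (fun w : Site (d + 1) => (if w ν % ((Lc * N : ℕ) : ℤ) = ((Lc * N : ℕ) : ℤ) - 1 then (1 : ℝ) else 0)) (fun _ => z) (fun w => w) b ν, faceface_wilsonA_diag_eq_zero (Lc * N) ν z b, mul_zero]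
  simp_rw [hR, mul_zero, Finset.sum_const_zero, tsum_zero, mul_zero]

/-- NOT IN PRINT; OUR BOOKKEEPING.  **LEFT DIAGONAL, UNIT-SCALED TABLE**: the cell pairing is `0`. -/
theorem cellPairing_zero_eq_zero_of_left_diag_units (sf sm cE : ℝ) (N : ℕ) [NeZero N] (μ ν β : Fin (d + 1)) :
    ∑ x ∈ box (d + 1) (Lc * N), ∑ a : Fin (d + 1),
        (∑' y : Site (d + 1), (if y μ % ((Lc * N : ℕ) : ℤ) = ((Lc * N : ℕ) : ℤ) - 1 then (1 : ℝ) else 0) *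
          ∑' t : Site (d + 1), (if t μ % ((Lc * N : ℕ) : ℤ) = ((Lc * N : ℕ) : ℤ) - 1 then
            unitS sf sm (fun κ u => cE • wilsonA d κ u) μ t y (toSite x) (Sum.inl μ) (Sum.inl a)
            else 0)) *
        (∑' z : Site (d + 1), ∑ b : Fin (d + 1), unitK sf sm (coDressKBmAt (toSite r) Lc (KInvStep (d := d) Lc 0)) (toSite x) z (Sum.inl a) (Sum.inl b) *
          (∑' w : Site (d + 1), (if w β % ((Lc * N : ℕ) : ℤ) = ((Lc * N : ℕ) : ℤ) - 1 then (1 : ℝ) else 0) *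
            ∑' t : Site (d + 1), (if t ν % ((Lc * N : ℕ) : ℤ) = ((Lc * N : ℕ) : ℤ) - 1 then
              unitS sf sm (fun κ u => cE • wilsonA d κ u) ν t z w (Sum.inl b) (Sum.inl β)
              else 0))) = 0 := by
  refine Finset.sum_eq_zero fun x _ => Finset.sum_eq_zero fun a _ => ?_
  rw [faceface_unitS_smul_wilsonA sf sm cE μ (fun t : Site (d + 1) => t μ % ((Lc * N : ℕ) : ℤ) = ((Lc * N : ℕ) : ℤ) - 1)
      (fun y : Site (d + 1) => (if y μ % ((Lc * N : ℕ) : ℤ) = ((Lc * N : ℕ) : ℤ) - 1 then (1 : ℝ) else 0)) (fun y => y) (fun _ => toSite x) μ a, faceface_wilsonA_diag_eq_zero_fst (Lc * N) μ (toSite x) a,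
    mul_zero, zero_mul]

end Summit.QuantumFields.BalabanUV.Beta.GAN24.FaceWordEEDiagZero

end
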